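import Summits.CriticalPhenomena.PercolationContinuityZ3.Theorems.PercNearOneGluingNoHeavyQuantVolumeTailDerivCritical
import Summits.CriticalPhenomena.PercolationContinuityZ3.Theorems.PercNearOneGluingNoHeavyQuantVolumeTailWindowFree
import HarnessLib

/-!
# THE CRITICAL CLUSTER-SIZE TAILS CROSS `p_c` WITH SLOPE OF ORDER EXACTLY ONE IN HIGH DIMENSIONS:
# `inf_{k ≥ k₀} (d/dp)P_p(|C| ≥ k)|_{p_c} > 0` AND `sup_k (d/dp)P_p(|C| ≥ k)|_{p_c} < ∞` under the ONE-SIDED mean-field tail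
# `P_{p_c}(|C| ≥ k) ≤ C₁k^{−1/2}` — UNCONDITIONALLY for every triangle-condition dimension and all `d ≥ D` (census V64, now two-sided);
# the lower bound persists throughout the parabolic window; general typed tails give `c ≤ a_k'(p_c) ≤ Ck^{1/2−1/δ}`
# — quant lane, METHOD = differential inequalities near `p_c`, seat p4 gen 37, file 6 (sequel of `…QuantVolumeTailWindowFree`)

builds on p205010 (kernel theorem, internal audit signed; external expert review pending).  (Nothing in THIS file uses p205010.)

Seat `prim-quant-p4`, `--supports stmt-CriticalPhenomena-4575`; pure proofs, no definitions (`local notation3` only).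
Notation: `A[k, q] = P_{PR q}(|C(0)| ≥ k)`, `S[k, p] = Σ_{j=1}^{k} P_p(|C| ≥ j) = E_p[|C| ∧ k]`, `PC = p_c`, `a_k = P_{p_c}(|C| ≥ k)`,
`S_k = S[k, p_c]`, `c_F = p_c(1−p_c)/(256d)` (the tree's product floor `a_k·S_k ≥ c_F`, `CritProduct.real_clusterSizeGe_mul_sum_ge`).

THE POINT.  File 2 of this generation (`…QuantVolumeTailDerivCritical`) bounded the critical derivatives of the volume tails FROM ABOVE
by the O'Donnell–Servedio mean-revealment inequality: `a_k'(p_c) ≤ √(4dC₁²/(p_c(1−p_c)))` under the mean-field upper tail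
`a_k ≤ C₁k^{−1/2}` (census V64: `sup_k a_k'(p_c) < ∞`).  Hutchcroft's volume differential inequality (Probab. Math. Phys. 1 (2020)
eq. (1.3); tree THEOREM `GhostExploration.hasDerivAt_volume_diffIneq`; division form `…WindowFree`'s `VolOS.hasDerivAt_volTail_ge_div`),
  `(d/dp)P_p(|C| ≥ k) ≥ [(1 − e⁻¹)k·P_p(|C| ≥ k)/E_p[|C|∧k] − P_p(|C| ≥ k)]/(2p(1−p))`   (every `p ∈ (0,1)`, including `p_c`),
bounds them FROM BELOW, and the product floor `a_kS_k ≥ c_F` (tree, gen 11) with `S_k ≤ 2C₁√k` gives `k·a_k/S_k ≥ p_c(1−p_c)/(1024dC₁²)`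
from the UPPER tail alone:
* §1 **MEAN-FIELD UPPER TAIL ⟹ TWO-SIDED: `(1−e⁻¹)/(2048dC₁²) − C₁k^{−1/2}/(2p_c(1−p_c)) ≤ a_k'(p_c) ≤ √(4dC₁²/(p_c(1−p_c)))`**, hence
  `∃ k₀ ∀ k ≥ k₀: (1−e⁻¹)/(4096dC₁²) ≤ a_k'(p_c) ≤ √(4dC₁²/(p_c(1−p_c)))`;
* §2 **UNCONDITIONAL for `TriangleCondition d` and for all `d ≥ D`** (`meanField_of_triangle`, `HaraSlade1990_triangleCondition_holds`, both
  PROVED in the tree; standard axioms): the critical volume tails cross `p_c` with slope `≍ 1`, uniformly in `k ≥ k₀` — census V64 of the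
  lane answered on BOTH sides in this regime;
* §3 general typed tails `c₁k^{−1/δ} ≤ a_k ≤ C₁k^{−1/δ}`: `a_k'(p_c) ≥ [(1−e⁻¹)c₁(1−1/δ)/C₁ − C₁k^{−1/δ}]/(2p_c(1−p_c))`, so with file 2
  **`c ≤ a_k'(p_c) ≤ C·k^{1/2−1/δ}`** for `k ≥ k₀` — two-sided of order one exactly when `δ = 2`;
* §4 **the lower bound persists in the window**: under the mean-field upper tail, for `|r − p_c| ≤ s`, `s·S_k ≤ p_c(1−p_c)/(128d)`,
  `k·s² ≤ p_c(1−p_c)/(64d)`: `2r(1−r)·a_k'(r) ≥ (1−e⁻¹)p_c(1−p_c)/(12288dC₁²) − 3C₁k^{−1/2}` (the hypothesis-free windows of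
  `…WindowFree`: `a_k/4 ≤ P_r(|C| ≥ k) ≤ 3a_k`, `E_r[|C|∧k] ≤ 3S_k`); with file 3's `a_k'(r) ≤ B/√(r(1−r))` on the same window (triangle
  condition) the cluster-size tails are uniformly BI-LIPSCHITZ in `p` across the parabolic window for `k ≥ k₀`.
Mean field (binary tree): `a_k'(p_c) → const > 0`, so §1 is order-sharp on both sides; for `3 ≤ d ≤ 6` the two bounds `c` and
`Ck^{1/2−1/δ}` of §3 do not meet (V64/V144 open there).

HONEST STATUS.  NEW AS TYPED: the two-sidedness of V64 (`a_k'(p_c) ≍ 1` uniformly in `k`, high `d`) and its window form; ELEMENTARY on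
printed, tree-proved inequalities (Hutchcroft 2020 (1.3); Hutchcroft 2022 Thm. 1.3; the gen-11 product floor = Thm. 1.3 +
Aizenman–Barsky/Duminil-Copin–Tassion; `δ = 2` under the triangle condition, Barsky–Aizenman 1991 / Hara–Slade 1990).  NO rate, NO
exponent value for `d = 3`; (T1)/(T2) and the lane's honest sentence UNCHANGED.

## References
* T. Hutchcroft, Probab. Math. Phys. 1 (2020) 147–165, eq. (1.3) [Hutchcroft2020].
* T. Hutchcroft, J. Stat. Phys. 189 (2022) no. 6, Thm. 1.3 [Hutchcroft2022Triangle].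
* R. O'Donnell, *Analysis of Boolean Functions* (2014), §8.6 (OS inequality) [ODonnell2014].
* R. Fitzner, R. van der Hofstad, Electron. J. Probab. 22 (2017), (1.6)–(1.8) [FitznerVanDerHofstad2017]; T. Hara, G. Slade,
  Comm. Math. Phys. 128 (1990), Thm. 1.1 [HaraSlade1990].
-/

noncomputable section

namespace Summit.CriticalPhenomena.PercolationContinuityZ3.Theorems

open MeasureTheory Finset Literature.Probability.Percolation Literature.Probability.LatticeModels
open Literature.Probability.Percolation.GhostExploration Literature.Probability.FitznerVanDerHofstad2017
open Literature.Barriers.CriticalPhenomena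
open scoped Classical

namespace VolOS

variable {d : ℕ}

local notation3 "PR[" q "]" => (Set.projIcc (0 : ℝ) 1 zero_le_one q)
local notation3 "A[" k ", " q "]" => (bondPercolation (zdGraph d) (Set.projIcc (0 : ℝ) 1 zero_le_one q)).real (clusterSizeGe (0 : Site d) (k : ℕ))
local notation3 "S[" k ", " p "]" => ∑ j ∈ Finset.Icc 1 k, (bondPercolation (zdGraph d) p).real (clusterSizeGe (0 : Site d) j)
local notation3 "PC" => ((criticalProbI d : unitInterval) : ℝ)

/-! ### §0. Two consequences of the mean-field upper tail: `S_k² ≤ 4C₁²k` and `k·a_k/S_k ≥ p_c(1−p_c)/(1024dC₁²)` -/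

/-- Under `P_{p_c}(|C| ≥ j) ≤ C₁j^{−1/2}` (`j ≥ 1`): `S_k² ≤ 4C₁²k` (`S_k ≤ C₁k^{1/2}/(1−1/2)`). [folklore] -/
theorem volSum_sq_le_of_mf_tail {C₁ : ℝ}
    (hUp : ∀ k : ℕ, 1 ≤ k → (bondPercolation (zdGraph d) (criticalProbI d)).real (clusterSizeGe (0 : Site d) k) ≤
      C₁ * (k : ℝ) ^ (-(1 / (2 : ℝ))))
    {k : ℕ} (hk : 1 ≤ k) : S[k, criticalProbI d] ^ 2 ≤ 4 * C₁ ^ 2 * k := by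
  have hk0 : (0 : ℝ) < k := by exact_mod_cast hk
  have hS0 : 0 ≤ S[k, criticalProbI d] := Finset.sum_nonneg fun j _ => measureReal_nonneg
  have hSle : S[k, criticalProbI d] ≤ C₁ * ((k : ℝ) ^ (1 - 1 / (2 : ℝ)) / (1 - 1 / 2)) :=
    volSum_criticalProbI_le_of_upper_tail (δ := 2) (by norm_num) hUp hk
  have hsq : ((k : ℝ) ^ (1 - 1 / (2 : ℝ))) ^ 2 = k := by
    rw [← Real.rpow_natCast, ← Real.rpow_mul hk0.le]; norm_num
  have h1 : S[k, criticalProbI d] ≤ 2 * C₁ * (k : ℝ) ^ (1 - 1 / (2 : ℝ)) := by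
    calc S[k, criticalProbI d] ≤ C₁ * ((k : ℝ) ^ (1 - 1 / (2 : ℝ)) / (1 - 1 / 2)) := hSle
      _ = 2 * C₁ * (k : ℝ) ^ (1 - 1 / (2 : ℝ)) := by ring
  calc S[k, criticalProbI d] ^ 2 ≤ (2 * C₁ * (k : ℝ) ^ (1 - 1 / (2 : ℝ))) ^ 2 := pow_le_pow_left₀ hS0 h1 2
    _ = 4 * C₁ ^ 2 * ((k : ℝ) ^ (1 - 1 / (2 : ℝ))) ^ 2 := by ring
    _ = 4 * C₁ ^ 2 * k := by rw [hsq]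

/-- Under `P_{p_c}(|C| ≥ j) ≤ C₁j^{−1/2}` (`j ≥ 1`), `d ≥ 2`, `k ≥ 1`: **`p_c(1−p_c)/(1024dC₁²) ≤ k·a_k/S_k`** (`k·a_k/S_k = k·a_kS_k/S_k² ≥
c_F·k/(4C₁²k)` by the product floor `a_kS_k ≥ c_F` and `S_k² ≤ 4C₁²k`).  [cite: Hutchcroft2022Triangle, Thm. 1.3] -/
theorem mul_volTail_div_volSum_ge_of_mf_tail (hd : 2 ≤ d) {C₁ : ℝ}
    (hUp : ∀ k : ℕ, 1 ≤ k → (bondPercolation (zdGraph d) (criticalProbI d)).real (clusterSizeGe (0 : Site d) k) ≤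
      C₁ * (k : ℝ) ^ (-(1 / (2 : ℝ))))
    {k : ℕ} (hk : 1 ≤ k) :
    PC * (1 - PC) / (1024 * d * C₁ ^ 2) ≤
      k * (bondPercolation (zdGraph d) (criticalProbI d)).real (clusterSizeGe (0 : Site d) k) / S[k, criticalProbI d] := by
  have hpc : PC ∈ Set.Ioo (0 : ℝ) 1 :=
    ⟨ChiF.criticalProbI_pos hd, by rw [coe_criticalProbI]; exact criticalProb_zd_lt_one hd⟩
  have hC₁ : 1 ≤ C₁ := by
    have h := hUp 1 le_rfl
    simp only [Nat.cast_one, Real.one_rpow, mul_one] at h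
    exact le_trans (by rw [CritProduct.real_clusterSizeGe_one]) h
  have hS2 := volSum_sq_le_of_mf_tail hUp hk
  have hfloor := CritProduct.real_clusterSizeGe_mul_sum_ge hd hk
  have hS1 : 1 ≤ S[k, criticalProbI d] := one_le_volSum (d := d) hk (criticalProbI d)
  set a : ℝ := (bondPercolation (zdGraph d) (criticalProbI d)).real (clusterSizeGe (0 : Site d) k) with ha
  set S : ℝ := S[k, criticalProbI d] with hS
  set P2 : ℝ := PC * (1 - PC) with hP2
  have hP20 : 0 < P2 := mul_pos hpc.1 (by linarith [hpc.2])
  have hS0 : 0 < S := by linarith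
  have hk0 : (0 : ℝ) < k := by exact_mod_cast hk
  have hd0 : (0 : ℝ) < d := by exact_mod_cast (show 0 < d by omega)
  have hC0 : 0 < C₁ := by linarith
  have ha0 : 0 ≤ a := measureReal_nonneg
  have heq : P2 / (1024 * d * C₁ ^ 2) = k * (P2 / (256 * d)) / (4 * C₁ ^ 2 * k) := by
    field_simp
    norm_num
  rw [heq]
  calc k * (P2 / (256 * d)) / (4 * C₁ ^ 2 * k) ≤ k * (P2 / (256 * d)) / S ^ 2 := by gcongr
    _ ≤ k * (a * S) / S ^ 2 := by gcongr
    _ = k * a / S := by rw [← mul_assoc, pow_two, mul_div_mul_right _ _ hS0.ne']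

/-! ### §1. The mean-field upper tail makes it two-sided: `a_k'(p_c) ≍ 1` uniformly in `k` (census V64, both sides) -/

/-- **MEAN-FIELD UPPER TAIL ⟹ `a_k'(p_c) ≍ 1`.**  `d ≥ 2`; if `P_{p_c}(|C| ≥ j) ≤ C₁j^{−1/2}` for all `j ≥ 1` then for every `k ≥ 1`
`d/dp P_p(|C| ≥ k)|_{p_c} = D` with
**`(1−e⁻¹)/(2048dC₁²) − C₁k^{−1/2}/(2p_c(1−p_c)) ≤ D ≤ √(4dC₁²/(p_c(1−p_c)))`** (Hutchcroft's (1.3) at `p_c` + §0; the upper bound is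
file 2's `hasDerivAt_volTail_criticalProbI_le_of_mf_tail`).  Only the UPPER tail is assumed.
[cite: Hutchcroft2020, eq. (1.3)] [cite: ODonnell2014, §8.6 OS Inequality] [cite: FitznerVanDerHofstad2017, (1.8)] -/
theorem hasDerivAt_volTail_criticalProbI_twoSided_of_mf_tail (hd : 2 ≤ d) {C₁ : ℝ}
    (hUp : ∀ k : ℕ, 1 ≤ k → (bondPercolation (zdGraph d) (criticalProbI d)).real (clusterSizeGe (0 : Site d) k) ≤
      C₁ * (k : ℝ) ^ (-(1 / (2 : ℝ))))
    {k : ℕ} (hk : 1 ≤ k) :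
    ∃ D : ℝ, HasDerivAt (fun q : ℝ => A[k, q]) D PC ∧
      (1 - Real.exp (-1)) / (2048 * d * C₁ ^ 2) - C₁ * (k : ℝ) ^ (-(1 / (2 : ℝ))) / (2 * (PC * (1 - PC))) ≤ D ∧
      D ≤ Real.sqrt (4 * d * C₁ ^ 2 / (PC * (1 - PC))) := by
  have hpc : PC ∈ Set.Ioo (0 : ℝ) 1 :=
    ⟨ChiF.criticalProbI_pos hd, by rw [coe_criticalProbI]; exact criticalProb_zd_lt_one hd⟩
  obtain ⟨D, hD, _, hDge⟩ := hasDerivAt_volTail_ge_div (d := d) hk hpc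
  obtain ⟨D', hD', _, hD'le⟩ := hasDerivAt_volTail_criticalProbI_le_of_mf_tail hd hUp hk
  have hDD : D = D' := hD.unique hD'
  refine ⟨D, hD, le_trans ?_ hDge, hDD ▸ hD'le⟩
  rw [volSum_PR_criticalProbI, volTail_PR_criticalProbI]
  have hkaS := mul_volTail_div_volSum_ge_of_mf_tail hd hUp hk
  have haup := hUp k hk
  set a : ℝ := (bondPercolation (zdGraph d) (criticalProbI d)).real (clusterSizeGe (0 : Site d) k) with ha
  set S : ℝ := S[k, criticalProbI d] with hS
  set e1 : ℝ := 1 - Real.exp (-1) with he1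
  set P2 : ℝ := PC * (1 - PC) with hP2
  have hP20 : 0 < P2 := mul_pos hpc.1 (by linarith [hpc.2])
  have he : 0 < e1 := by rw [he1]; linarith [Real.exp_lt_one_iff.2 (show (-1 : ℝ) < 0 by norm_num)]
  have hd0 : (0 : ℝ) < d := by exact_mod_cast (show 0 < d by omega)
  have hC0 : 0 < C₁ := by
    have h := hUp 1 le_rfl
    simp only [Nat.cast_one, Real.one_rpow, mul_one] at h
    linarith [le_trans (by rw [CritProduct.real_clusterSizeGe_one]) h]
  have heq : e1 / (2048 * d * C₁ ^ 2) = e1 * (P2 / (1024 * d * C₁ ^ 2)) / (2 * P2) := by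
    field_simp
    norm_num
  rw [heq, ← sub_div]
  refine div_le_div_of_nonneg_right ?_ (by positivity)
  calc e1 * (P2 / (1024 * d * C₁ ^ 2)) - C₁ * (k : ℝ) ^ (-(1 / (2 : ℝ)))
      ≤ e1 * (k * a / S) - a := sub_le_sub (mul_le_mul_of_nonneg_left hkaS he.le) haup
    _ = e1 * k * a / S - a := by ring

/-- **UNIFORMLY TWO-SIDED FOR `k ≥ k₀`**: under the mean-field upper tail there is `k₀ ≥ 1` such that for every `k ≥ k₀`
`d/dp P_p(|C| ≥ k)|_{p_c} = D` with **`(1−e⁻¹)/(4096dC₁²) ≤ D ≤ √(4dC₁²/(p_c(1−p_c)))`** (`k₀`: `C₁k^{−1/2}/(2p_c(1−p_c)) ≤ (1−e⁻¹)/(4096dC₁²)`).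
[cite: Hutchcroft2020, eq. (1.3)] [cite: ODonnell2014, §8.6 OS Inequality] -/
theorem volTail_deriv_twoSided_of_mf_tail (hd : 2 ≤ d) {C₁ : ℝ}
    (hUp : ∀ k : ℕ, 1 ≤ k → (bondPercolation (zdGraph d) (criticalProbI d)).real (clusterSizeGe (0 : Site d) k) ≤
      C₁ * (k : ℝ) ^ (-(1 / (2 : ℝ)))) :
    ∃ k₀ : ℕ, 1 ≤ k₀ ∧ ∀ k : ℕ, k₀ ≤ k → ∃ D : ℝ, HasDerivAt (fun q : ℝ => A[k, q]) D PC ∧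
      (1 - Real.exp (-1)) / (4096 * d * C₁ ^ 2) ≤ D ∧ D ≤ Real.sqrt (4 * d * C₁ ^ 2 / (PC * (1 - PC))) := by
  have hpc : PC ∈ Set.Ioo (0 : ℝ) 1 :=
    ⟨ChiF.criticalProbI_pos hd, by rw [coe_criticalProbI]; exact criticalProb_zd_lt_one hd⟩
  have hC0 : 0 < C₁ := by
    have h := hUp 1 le_rfl
    simp only [Nat.cast_one, Real.one_rpow, mul_one] at h
    linarith [le_trans (by rw [CritProduct.real_clusterSizeGe_one]) h]
  have hd0 : (0 : ℝ) < d := by exact_mod_cast (show 0 < d by omega)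
  have hpp : 0 < 2 * (PC * (1 - PC)) := by nlinarith [hpc.1, hpc.2]
  have he : 0 < 1 - Real.exp (-1) := by linarith [Real.exp_lt_one_iff.2 (show (-1 : ℝ) < 0 by norm_num)]
  have hb0 : 0 < (1 - Real.exp (-1)) / (4096 * d * C₁ ^ 2) := div_pos he (by positivity)
  set b : ℝ := (1 - Real.exp (-1)) / (4096 * d * C₁ ^ 2) with hb
  -- `X = C₁/(2p_c(1−p_c)·b)`; for `k ≥ X²`: `C₁k^{−1/2}/(2p_c(1−p_c)) ≤ b`
  set X : ℝ := C₁ / (2 * (PC * (1 - PC)) * b) with hX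
  have hX0 : 0 < X := div_pos hC0 (mul_pos hpp hb0)
  refine ⟨⌈X ^ 2⌉₊ + 1, by omega, fun k hk => ?_⟩
  have hk1 : 1 ≤ k := by omega
  have hk0 : (0 : ℝ) < k := by exact_mod_cast hk1
  obtain ⟨D, hD, hDge, hDle⟩ := hasDerivAt_volTail_criticalProbI_twoSided_of_mf_tail hd hUp hk1
  refine ⟨D, hD, le_trans ?_ hDge, hDle⟩
  have hkX : X ^ 2 ≤ k := by
    have h1 : X ^ 2 ≤ ⌈X ^ 2⌉₊ := Nat.le_ceil _
    have h2 : ((⌈X ^ 2⌉₊ : ℕ) : ℝ) ≤ k := by exact_mod_cast (by omega : ⌈X ^ 2⌉₊ ≤ k)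
    linarith
  have hsk : X ≤ Real.sqrt k := by
    rw [← Real.sqrt_sq hX0.le]; exact Real.sqrt_le_sqrt hkX
  have hterm : C₁ * (k : ℝ) ^ (-(1 / (2 : ℝ))) / (2 * (PC * (1 - PC))) ≤ b := by
    rw [← div_sqrt_eq_mul_rpow hk0]
    calc C₁ / Real.sqrt k / (2 * (PC * (1 - PC))) ≤ C₁ / X / (2 * (PC * (1 - PC))) := by
          gcongr
      _ = b := by
          rw [hX, div_div_eq_mul_div, mul_div_cancel_left₀ _ hC0.ne', mul_div_cancel_left₀ _ hpp.ne']
  have h2b : 2 * b = (1 - Real.exp (-1)) / (2048 * d * C₁ ^ 2) := by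
    rw [hb, ← mul_div_assoc, show (4096 : ℝ) * d * C₁ ^ 2 = 2 * (2048 * d * C₁ ^ 2) by ring,
      mul_div_mul_left _ _ (two_ne_zero)]
  linarith

/-! ### §2. Unconditional corollaries: the triangle condition, and all sufficiently high dimensions -/

/-- **UNCONDITIONAL UNDER THE TRIANGLE CONDITION: the critical volume tails cross `p_c` with slope `≍ 1`, uniformly in `k ≥ k₀`** —
`TriangleCondition d ⟹ ∃ k₀ b B, 0 < b ∧ ∀ k ≥ k₀: b ≤ (d/dp)P_p(|C| ≥ k)|_{p_c} ≤ B` (`δ = 2` in the bounded-ratio sense under the triangle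
condition, `meanField_of_triangle`, gives the upper envelope `C₁k^{−1/2}`; §1).  Census V64 of the lane, BOTH sides.
[cite: FitznerVanDerHofstad2017, Thm. 1.2 / (1.8)] [cite: Hutchcroft2020, eq. (1.3)] [cite: ODonnell2014, §8.6 OS Inequality] -/
theorem volTail_deriv_twoSided_of_triangle (hd : 2 ≤ d) (hT : TriangleCondition d) :
    ∃ k₀ : ℕ, ∃ b B : ℝ, 0 < b ∧ ∀ k : ℕ, k₀ ≤ k → ∃ D : ℝ, HasDerivAt (fun q : ℝ => A[k, q]) D PC ∧ b ≤ D ∧ D ≤ B := by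
  obtain ⟨C₁, hC₁, hUp⟩ := upper_tail_of_deltaEqTwo (meanField_of_triangle hd hT).2.2.2
  obtain ⟨k₀, _, hk₀⟩ := volTail_deriv_twoSided_of_mf_tail hd hUp
  have hd0 : (0 : ℝ) < d := by exact_mod_cast (show 0 < d by omega)
  have he : 0 < 1 - Real.exp (-1) := by linarith [Real.exp_lt_one_iff.2 (show (-1 : ℝ) < 0 by norm_num)]
  exact ⟨k₀, (1 - Real.exp (-1)) / (4096 * d * C₁ ^ 2), Real.sqrt (4 * d * C₁ ^ 2 / (PC * (1 - PC))),
    div_pos he (by positivity), hk₀⟩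

/-- **IN ALL SUFFICIENTLY HIGH DIMENSIONS THE CRITICAL VOLUME TAILS OF `ℤ^d` CROSS `p_c` WITH SLOPE OF ORDER ONE**: there is `D > 6` such
that for every `d ≥ D` there are `k₀` and `0 < b`, `B` with `b ≤ (d/dp)P_p(|C(0)| ≥ k)|_{p = p_c(ℤ^d)} ≤ B` for all `k ≥ k₀` (Hara–Slade: the
triangle condition holds for `d ≥ D`, tree `HaraSlade1990_triangleCondition_holds`).  Standard axioms; unconditional.
[cite: HaraSlade1990, Thm. 1.1] [cite: Hutchcroft2020, eq. (1.3)] [cite: ODonnell2014, §8.6 OS Inequality] -/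
theorem volTail_deriv_twoSided_high_dim :
    ∃ D : ℕ, 6 < D ∧ ∀ d' : ℕ, D ≤ d' → ∃ k₀ : ℕ, ∃ b B : ℝ, 0 < b ∧ ∀ k : ℕ, k₀ ≤ k → ∃ D' : ℝ,
      HasDerivAt (fun q : ℝ => (bondPercolation (zdGraph d') (Set.projIcc (0 : ℝ) 1 zero_le_one q)).real
        (clusterSizeGe (0 : Site d') k)) D' ((criticalProbI d' : unitInterval) : ℝ) ∧ b ≤ D' ∧ D' ≤ B := by
  obtain ⟨D, hD, hT⟩ := HaraSlade1990_triangleCondition_holds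
  exact ⟨D, hD, fun d' hd' => volTail_deriv_twoSided_of_triangle (d := d') (by omega) (hT d' hd')⟩

/-! ### §3. General typed tails: `c ≤ a_k'(p_c) ≤ C·k^{1/2−1/δ}` -/

/-- **TWO-SIDED TYPED TAIL ⟹ `liminf_k a_k'(p_c) > 0`.**  `d ≥ 2`, `δ > 1`, `c₁k^{−1/δ} ≤ P_{p_c}(|C| ≥ k) ≤ C₁k^{−1/δ}` (`k ≥ 1`).  Then for
every `k ≥ 1`: `d/dp P_p(|C| ≥ k)|_{p_c} = D` with **`D ≥ [(1−e⁻¹)·c₁(1−1/δ)/C₁ − C₁k^{−1/δ}]/(2p_c(1−p_c))`** (`k·a_k/S_k ≥ c₁(1−1/δ)/C₁`).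
With file 2's `D ≤ √(2dC₁²/((1−1/δ)p_c(1−p_c)))·k^{1/2−1/δ}`: two-sided of order one exactly when `δ = 2`.
[cite: Hutchcroft2020, eq. (1.3)] [cite: Newman1987BetaDelta, main theorem (β ≥ 2/δ)] -/
theorem hasDerivAt_volTail_criticalProbI_ge_of_tails (hd : 2 ≤ d) {δ c₁ C₁ : ℝ} (hδ : 1 < δ) (hc₁ : 0 < c₁)
    (hLo : ∀ k : ℕ, 1 ≤ k → c₁ * (k : ℝ) ^ (-(1 / δ)) ≤
      (bondPercolation (zdGraph d) (criticalProbI d)).real (clusterSizeGe (0 : Site d) k))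
    (hUp : ∀ k : ℕ, 1 ≤ k → (bondPercolation (zdGraph d) (criticalProbI d)).real (clusterSizeGe (0 : Site d) k) ≤
      C₁ * (k : ℝ) ^ (-(1 / δ)))
    {k : ℕ} (hk : 1 ≤ k) :
    ∃ D : ℝ, HasDerivAt (fun q : ℝ => A[k, q]) D PC ∧
      ((1 - Real.exp (-1)) * (c₁ * (1 - 1 / δ) / C₁) - C₁ * (k : ℝ) ^ (-(1 / δ))) / (2 * (PC * (1 - PC))) ≤ D := by
  have hpc : PC ∈ Set.Ioo (0 : ℝ) 1 :=
    ⟨ChiF.criticalProbI_pos hd, by rw [coe_criticalProbI]; exact criticalProb_zd_lt_one hd⟩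
  obtain ⟨D, hD, _, hDge⟩ := hasDerivAt_volTail_ge_div (d := d) hk hpc
  refine ⟨D, hD, le_trans ?_ hDge⟩
  rw [volSum_PR_criticalProbI, volTail_PR_criticalProbI]
  have hδ0 : 0 < δ := by linarith
  have h1δ : 0 < 1 - 1 / δ := by
    have : 1 / δ < 1 := by rw [div_lt_one hδ0]; exact hδ
    linarith
  have hk0 : (0 : ℝ) < k := by exact_mod_cast hk
  -- `k · k^{−1/δ} = k^{1−1/δ}`
  have hkk : (k : ℝ) * (k : ℝ) ^ (-(1 / δ)) = (k : ℝ) ^ (1 - 1 / δ) := by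
    rw [show (1 : ℝ) - 1 / δ = 1 + (-(1 / δ)) by ring, Real.rpow_add hk0, Real.rpow_one]
  have hSle : S[k, criticalProbI d] ≤ C₁ * ((k : ℝ) ^ (1 - 1 / δ) / (1 - 1 / δ)) :=
    volSum_criticalProbI_le_of_upper_tail hδ hUp hk
  have halo := hLo k hk
  have haup := hUp k hk
  have hS1 : 1 ≤ S[k, criticalProbI d] := one_le_volSum (d := d) hk (criticalProbI d)
  set a : ℝ := (bondPercolation (zdGraph d) (criticalProbI d)).real (clusterSizeGe (0 : Site d) k) with ha
  set S : ℝ := S[k, criticalProbI d] with hS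
  set e1 : ℝ := 1 - Real.exp (-1) with he1
  set t : ℝ := 1 - 1 / δ with ht
  have he : 0 < e1 := by rw [he1]; linarith [Real.exp_lt_one_iff.2 (show (-1 : ℝ) < 0 by norm_num)]
  have hS0 : 0 < S := by linarith
  have hkpow : 0 < (k : ℝ) ^ (-(1 / δ)) := Real.rpow_pos_of_pos hk0 _
  have hC0 : 0 < C₁ := by
    have h : 0 < C₁ * (k : ℝ) ^ (-(1 / δ)) := (mul_pos hc₁ hkpow).trans_le (halo.trans haup)
    exact (mul_pos_iff_of_pos_right hkpow).mp h
  have hpp : 0 < 2 * (PC * (1 - PC)) := by nlinarith [hpc.1, hpc.2]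
  -- `c₁ t / C₁ ≤ k·a/S`
  have h1 : c₁ * t / C₁ ≤ k * a / S := by
    rw [div_le_div_iff₀ hC0 hS0]
    calc c₁ * t * S ≤ c₁ * t * (C₁ * ((k : ℝ) ^ t / t)) := mul_le_mul_of_nonneg_left hSle (by positivity)
      _ = C₁ * (c₁ * (t * (k : ℝ) ^ t / t)) := by ring
      _ = C₁ * (c₁ * (k : ℝ) ^ t) := by rw [mul_div_cancel_left₀ _ h1δ.ne']
      _ = C₁ * ((k : ℝ) * (c₁ * (k : ℝ) ^ (-(1 / δ)))) := by rw [← hkk]; ring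
      _ ≤ C₁ * ((k : ℝ) * a) := by gcongr
      _ = k * a * C₁ := by ring
  refine div_le_div_of_nonneg_right ?_ hpp.le
  calc e1 * (c₁ * t / C₁) - C₁ * (k : ℝ) ^ (-(1 / δ))
      ≤ e1 * (k * a / S) - a := sub_le_sub (mul_le_mul_of_nonneg_left h1 he.le) haup
    _ = e1 * k * a / S - a := by ring

/-! ### §4. The lower bound persists throughout the parabolic window -/

/-- **CO-LIPSCHITZ IN THE WINDOW (mean-field upper tail).**  `d ≥ 2`, `P_{p_c}(|C| ≥ j) ≤ C₁j^{−1/2}` (`j ≥ 1`); `0 < s ≤ min(p_c, 1−p_c)/2`,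
`k ≥ 1` in the hypothesis-free windows `s·E_{p_c}[|C|∧k] ≤ p_c(1−p_c)/(128d)`, `k·s² ≤ p_c(1−p_c)/(64d)` (both hold when
`k·s² ≤ (p_c(1−p_c)/(256dC₁))²`, as `S_k ≤ 2C₁√k`).  Then for every `r ∈ [p_c − s, p_c + s]`: `d/dr P_r(|C| ≥ k) = D` with
**`2r(1−r)·D ≥ (1−e⁻¹)·p_c(1−p_c)/(12288dC₁²) − 3C₁k^{−1/2}`** — Hutchcroft's (1.3) at `r`, with `a_k/4 ≤ P_r(|C| ≥ k) ≤ 3a_k` and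
`E_r[|C|∧k] ≤ 3S_k` (`…WindowFree`) and `k·a_k/S_k ≥ p_c(1−p_c)/(1024dC₁²)` (§0).  With file 3 (`D ≤ B/√(r(1−r))` on the same window,
triangle condition): the cluster-size tails are uniformly bi-Lipschitz in `p` across the parabolic window for `k ≥ k₀`.
[cite: Hutchcroft2020, eq. (1.3)] [cite: Hutchcroft2022Triangle, Thm. 1.3] -/
theorem hasDerivAt_volTail_ge_window_of_mf_tail (hd : 2 ≤ d) {C₁ : ℝ}
    (hUp : ∀ k : ℕ, 1 ≤ k → (bondPercolation (zdGraph d) (criticalProbI d)).real (clusterSizeGe (0 : Site d) k) ≤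
      C₁ * (k : ℝ) ^ (-(1 / (2 : ℝ))))
    {s : ℝ} (hs0 : 0 < s) (hs1 : s ≤ PC / 2) (hs2 : s ≤ (1 - PC) / 2) {k : ℕ} (hk : 1 ≤ k)
    (hsS : s * S[k, criticalProbI d] ≤ PC * (1 - PC) / (128 * d)) (hks : (k : ℝ) * s ^ 2 ≤ PC * (1 - PC) / (64 * d))
    {r : ℝ} (hr : r ∈ Set.Icc (PC - s) (PC + s)) :
    ∃ D : ℝ, HasDerivAt (fun q : ℝ => A[k, q]) D r ∧
      (1 - Real.exp (-1)) * (PC * (1 - PC)) / (12288 * d * C₁ ^ 2) - 3 * C₁ * (k : ℝ) ^ (-(1 / (2 : ℝ)))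
        ≤ 2 * (r * (1 - r)) * D := by
  have hpc : PC ∈ Set.Ioo (0 : ℝ) 1 :=
    ⟨ChiF.criticalProbI_pos hd, by rw [coe_criticalProbI]; exact criticalProb_zd_lt_one hd⟩
  have hr01 : r ∈ Set.Ioo (0 : ℝ) 1 := ⟨by linarith [hr.1, hpc.1], by linarith [hr.2, hpc.2]⟩
  obtain ⟨D, hD, _, hDge⟩ := hasDerivAt_volTail_ge_div (d := d) hk hr01
  refine ⟨D, hD, ?_⟩
  have hrr : 0 < 2 * (r * (1 - r)) := by nlinarith [hr01.1, hr01.2]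
  have hmain : (1 - Real.exp (-1)) * k * A[k, r] / S[k, PR[r]] - A[k, r] ≤ 2 * (r * (1 - r)) * D := by
    have h := (div_le_iff₀ hrr).1 hDge
    linarith
  refine le_trans ?_ hmain
  have hkaS := mul_volTail_div_volSum_ge_of_mf_tail hd hUp hk
  have haup := hUp k hk
  have hS1 : 1 ≤ S[k, criticalProbI d] := one_le_volSum (d := d) hk (criticalProbI d)
  have hSr1 : 1 ≤ S[k, PR[r]] := one_le_volSum (d := d) hk PR[r]
  have ha0 : 0 ≤ (bondPercolation (zdGraph d) (criticalProbI d)).real (clusterSizeGe (0 : Site d) k) := measureReal_nonneg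
  have hSnn : 0 ≤ S[k, criticalProbI d] := by linarith
  -- the window comparisons `a_k/4 ≤ A_r ≤ 3a_k`, `S_r ≤ 3S_k` (two half-windows)
  have hwin : (bondPercolation (zdGraph d) (criticalProbI d)).real (clusterSizeGe (0 : Site d) k) / 4 ≤ A[k, r] ∧
      A[k, r] ≤ 3 * (bondPercolation (zdGraph d) (criticalProbI d)).real (clusterSizeGe (0 : Site d) k) ∧
      S[k, PR[r]] ≤ 3 * S[k, criticalProbI d] := by
    rcases le_or_gt r PC with hrc | hrc
    · have hAr_le : A[k, r] ≤ (bondPercolation (zdGraph d) (criticalProbI d)).real (clusterSizeGe (0 : Site d) k) :=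
        (volTail_mono' k hrc).trans_eq (volTail_PR_criticalProbI k)
      have hSr_le : S[k, PR[r]] ≤ S[k, criticalProbI d] := by
        have h : (PR[r] : unitInterval) ≤ PR[PC] := Set.monotone_projIcc _ hrc
        rw [Set.projIcc_val] at h
        exact volSumIcc_mono k h
      have hAr_ge : (bondPercolation (zdGraph d) (criticalProbI d)).real (clusterSizeGe (0 : Site d) k) / 4 ≤ A[k, r] := by
        rcases eq_or_lt_of_le hrc with hre | hrl
        · rw [hre, volTail_PR_criticalProbI]; linarith
        · have h := volTail_subcrit_persist_free hd (s := PC - r) (by linarith) (by linarith [hr01.1]) hk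
            (le_trans (mul_le_mul_of_nonneg_right (by linarith [hr.1]) hSnn) hsS)
          rwa [show PC - (PC - r) = r by ring] at h
      exact ⟨hAr_ge, by linarith, by linarith⟩
    · have hs' : 0 < r - PC := by linarith
      have hAr_ge : (bondPercolation (zdGraph d) (criticalProbI d)).real (clusterSizeGe (0 : Site d) k) ≤ A[k, r] :=
        (volTail_PR_criticalProbI k).symm.trans_le (volTail_mono' k hrc.le)
      have hAr_le : A[k, r] ≤ 3 * (bondPercolation (zdGraph d) (criticalProbI d)).real (clusterSizeGe (0 : Site d) k) := by
        have h := volTail_supercrit_le_three_free hd (s := r - PC) hs' (by linarith [hr.2]) hk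
          (le_trans (mul_le_mul_of_nonneg_right (by linarith [hr.2]) hSnn) hsS)
        rwa [show PC + (r - PC) = r by ring] at h
      have hSr_le : S[k, PR[r]] ≤ 3 * S[k, criticalProbI d] := by
        have hsq' : (r - PC) ^ 2 ≤ s ^ 2 := pow_le_pow_left₀ hs'.le (by linarith [hr.2]) 2
        have h := volSum_supercrit_le_three_free hd (s := r - PC) hs' (by linarith [hr.2]) (k := k)
          (le_trans (mul_le_mul_of_nonneg_left hsq' (Nat.cast_nonneg k)) hks)
        rwa [show PC + (r - PC) = r by ring] at h
      exact ⟨by linarith, hAr_le, hSr_le⟩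
  obtain ⟨hAr_ge, hAr_le, hSr_le⟩ := hwin
  set a : ℝ := (bondPercolation (zdGraph d) (criticalProbI d)).real (clusterSizeGe (0 : Site d) k) with ha
  set S : ℝ := S[k, criticalProbI d] with hS
  set Ar : ℝ := A[k, r] with hAr
  set Sr : ℝ := S[k, PR[r]] with hSr
  set e1 : ℝ := 1 - Real.exp (-1) with he1
  set P2 : ℝ := PC * (1 - PC) with hP2
  have hP20 : 0 < P2 := mul_pos hpc.1 (by linarith [hpc.2])
  have he : 0 < e1 := by rw [he1]; linarith [Real.exp_lt_one_iff.2 (show (-1 : ℝ) < 0 by norm_num)]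
  have hS0 : 0 < S := by linarith
  have hSr0 : 0 < Sr := by linarith
  have hk0 : (0 : ℝ) < k := by exact_mod_cast hk
  have hd0 : (0 : ℝ) < d := by exact_mod_cast (show 0 < d by omega)
  have hC0 : 0 < C₁ := by
    have h := hUp 1 le_rfl
    simp only [Nat.cast_one, Real.one_rpow, mul_one] at h
    linarith [le_trans (by rw [CritProduct.real_clusterSizeGe_one]) h]
  have hAr0 : 0 ≤ Ar := le_trans (by positivity) hAr_ge
  have hkpow : 0 ≤ C₁ * (k : ℝ) ^ (-(1 / (2 : ℝ))) := mul_nonneg hC0.le (Real.rpow_nonneg hk0.le _)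
  -- `k·(a/4)/(3S) ≤ k·A_r/S_r`
  have h2 : k * (a / 4) / (3 * S) ≤ k * Ar / Sr := by gcongr
  have h3 : e1 * (k * (a / 4) / (3 * S)) ≤ e1 * (k * Ar / Sr) := mul_le_mul_of_nonneg_left h2 he.le
  have h1 : e1 * (P2 / (1024 * d * C₁ ^ 2)) ≤ e1 * (k * a / S) := mul_le_mul_of_nonneg_left hkaS he.le
  have hid1 : e1 * (k * (a / 4) / (3 * S)) = e1 * (k * a / S) / 12 := by
    field_simp
    ring
  have hid2 : e1 * P2 / (12288 * d * C₁ ^ 2) = e1 * (P2 / (1024 * d * C₁ ^ 2)) / 12 := by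
    field_simp
    norm_num
  have hid3 : e1 * (k * Ar / Sr) = e1 * k * Ar / Sr := by ring
  rw [hid2, ← hid3]
  linarith

end VolOS

end Summit.CriticalPhenomena.PercolationContinuityZ3.Theorems
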